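import Literature.AlgebraicGeometry.GroupSchemes.StrictBirationalGroupLaw
import Mathlib.AlgebraicGeometry.Geometrically.Irreducible
import Mathlib.AlgebraicGeometry.PullbackCarrier
import HarnessLib

/-!
# «`b x⁻¹` and `a (b x⁻¹)` are defined for a generic `x`»: right division is defined generically over every point
# (Artin, *Néron models*, §2, last paragraph of the proof of Thm. (1.12))

Topic `Literature/AlgebraicGeometry/GroupSchemes`, namespace `Literature.AlgebraicGeometry.GroupSchemes`.
THEOREMS ONLY (no definition, no named fact, no instance, no `sorry`).  Cell `hodgecm-mathlib` (D-0151), road W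
(Néron capital), (W1) step (G3b) «StageSaturate», layer 2 (ii): the RIGHT-DIVISION TWIN of
★ `BirationalGroupLaw.fibre_subset_closure_translateDom` (`BirationalGroupLawGenericTranslate.lean`).

Artin's saturation step ([Artin1986NeronModels] p. 222–223) takes `(a, b) ∈ V²` and a section `x` «generic» and uses
that `c = a (b x⁻¹)` is defined: `b x⁻¹` defined means `(b, x)` lies in the image `U₂₃` of the right shear
`Ψ : (y, x) ↦ (y x, x)`, and then `(a, b x⁻¹) = (a, pr₁ Ψ⁻¹(b, x))` must lie in the domain `dom` of the law.  For SCHEME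
points `a, b` this is a statement about the point `(x, (a, b))` of `W = V ×_S (V ×_S V)` over the point `p₀ = (a, b)`
of `V ×_S V`; by the bridge `GroupSchemes.exists_open_forall_section_lift_mem` (`SectionsThroughFibreDenseOpens.lean`)
it is available for the sections through some open meeting the fibre `V_s` as soon as the open

  `O₂ = {(x, (a, b)) : (b, x) ∈ U₂₃ ∧ (a, pr₁ Ψ⁻¹(b, x)) ∈ dom} ⊆ W`

is DENSE IN THE FIBRE of `pr₂ : W ⟶ V ×_S V` over `p₀`.  This file proves that density
(`BirationalGroupLaw.fibre_subset_closure_rightDivDom`) for a STRICT law on `𝒳 → S` universally open with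
geometrically irreducible fibres: the fibre `F` over `p₀` is irreducible with generic point `ζ`; the morphism
`ϖ = (x, (a, b)) ↦ (b, x)` is a base change mapping `F` onto the `pr₁`-fibre of `V ×_S V` over `b`, so `ϖ(ζ)` is generic
there and lies in the fibrewise-dense open `U₂₃` (strictness); on `A = ϖ⁻¹ U₂₃` the morphism
`Ψ₃ = (x, (a, b)) ↦ (c, (a, b))`, `c = pr₁ Ψ⁻¹(b, x)`, is the base change of the LEFT shear `Φ : (c, x) ↦ (c, c x)` along
`β = (u, (a, b)) ↦ (u, b)` (an open immersion preserving `F`), and `Θ = (x, (a, b)) ↦ (a, c)` factors as `Ψ₃` followed by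
the base change `γ = (u, (a, b)) ↦ (a, u)` onto the `pr₁`-fibre over `a`; so `Θ(ζ)` is generic in `pr₁⁻¹(a)`, hence in
`dom` by strictness.  Banked leaf; no floor change.  HC_CM is proved only modulo the 7 printed citations until rung 0
closes.

## References
* [Artin1986NeronModels] M. Artin, *Néron models*, in Cornell–Silverman (eds.), *Arithmetic Geometry*, Springer
  1986, §2, last paragraph of the proof of Thm. (1.12) (p. 222–223), and (2.2) (p. 221).
* [EdixhovenRomagny] B. Edixhoven, M. Romagny, *Group schemes out of birational group laws, Néron models*, Panor.
  Synthèses 47 (2015), Def. 3.4 (2) (strictness on `T`-points), Lemmas 3.19–3.21.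
-/

set_option autoImplicit false

noncomputable section

namespace Literature.AlgebraicGeometry.GroupSchemes

open CategoryTheory CategoryTheory.Limits _root_.AlgebraicGeometry MonoidalCategory CartesianMonoidalCategory
open TopologicalSpace Topology
open scoped CategoryTheory.Obj

universe u

variable {S : Scheme.{u}} {𝒳 : Over S}

/-! ## §1. Generic points of fibres -/

/-- A point `ζ` of an irreducible fibre `h⁻¹(y)` which is generic in it: `ζ ∈ h⁻¹(y)` and
`h⁻¹(y) ⊆ closure {ζ}`. [folklore] -/
private theorem exists_generic_of_isIrreducible_fibre' {W P : Scheme.{u}} (h : W ⟶ P) (y : P)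
    (hirr : IsIrreducible (h ⁻¹' {y})) : ∃ ζ : W, h ζ = y ∧ h ⁻¹' {y} ⊆ closure {ζ} := by
  set Z : Set W := h ⁻¹' {y} with hZ
  have hgen : IsGenericPoint hirr.genericPoint (closure Z) := hirr.isGenericPoint_genericPoint_closure
  set ζ := hirr.genericPoint with hζ
  have hZsub : Z ⊆ closure {ζ} := by rw [hgen]; exact subset_closure
  refine ⟨ζ, ?_, hZsub⟩
  have hζcl : ζ ∈ closure Z := by rw [← hgen]; exact subset_closure (Set.mem_singleton ζ)
  have h1 : h ζ ∈ closure {y} := by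
    have : h '' closure Z ⊆ closure (h '' Z) := image_closure_subset_closure_image h.continuous
    have hy : h '' Z ⊆ {y} := by rintro _ ⟨w, hw, rfl⟩; exact hw
    exact closure_mono hy (this ⟨ζ, hζcl, rfl⟩)
  obtain ⟨z, hz⟩ := hirr.nonempty
  have h2 : y ∈ closure {h ζ} := by
    have hz' : z ∈ closure {ζ} := hZsub hz
    have : h z ∈ closure {h ζ} := by
      have := image_closure_subset_closure_image h.continuous ⟨z, hz', rfl⟩
      rwa [Set.image_singleton] at this
    rw [show h z = y from hz] at this
    exact this
  have hs1 : h ζ ⤳ y := specializes_iff_mem_closure.mpr h2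
  have hs2 : y ⤳ h ζ := specializes_iff_mem_closure.mpr h1
  exact (hs1.antisymm hs2).eq

/-- A point generic in a set lies in every open set meeting it. [folklore] -/
private theorem mem_of_isOpen_of_inter_nonempty' {W : Scheme.{u}} {Z : Set W} {ζ : W} (hZ : Z ⊆ closure {ζ})
    {O : Set W} (hO : IsOpen O) (hne : (O ∩ Z).Nonempty) : ζ ∈ O := by
  obtain ⟨w, hwO, hwZ⟩ := hne
  have hw : w ∈ closure ({ζ} : Set W) := hZ hwZ
  rw [mem_closure_iff] at hw
  obtain ⟨_, h1, rfl⟩ := hw O hO hwO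
  exact h1

/-- If a morphism maps a set `Z`, generic point `ζ`, ONTO a set `Z'`, then `Z' ⊆ closure {f ζ}`. [folklore] -/
private theorem subset_closure_image_of_surjOn' {W P : Scheme.{u}} (f : W ⟶ P) {Z : Set W} {ζ : W}
    (hZ : Z ⊆ closure {ζ}) {Z' : Set P} (hsurj : Z' ⊆ f '' Z) : Z' ⊆ closure {f ζ} := by
  intro z' hz'
  obtain ⟨z, hz, rfl⟩ := hsurj hz'
  have := image_closure_subset_closure_image f.continuous ⟨z, hZ hz, rfl⟩
  rwa [Set.image_singleton] at this

/-! ## §2. The maps `ϖ = (x,(a,b)) ↦ (b,x)` and `γ = (u,(a,b)) ↦ (a,u)` are base changes -/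

section Coordinates

variable (𝒳)

/-- A morphism `ϖ : V ×_S (V ×_S V) ⟶ V ×_S V` with coordinates `(x, (a, b)) ↦ (b, x)` is a base change: the square
with `pr₂` and the FIRST projection over `snd : V ×_S V ⟶ V` is cartesian. [folklore] -/
private theorem isPullback_of_coord_swap (ϖ : pullback 𝒳.hom (𝒳 ⊗ 𝒳).hom ⟶ (𝒳 ⊗ 𝒳).left)
    (h1 : ϖ ≫ (fst 𝒳 𝒳).left = pullback.snd 𝒳.hom (𝒳 ⊗ 𝒳).hom ≫ (snd 𝒳 𝒳).left)
    (h2 : ϖ ≫ (snd 𝒳 𝒳).left = pullback.fst 𝒳.hom (𝒳 ⊗ 𝒳).hom) :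
    IsPullback ϖ (pullback.snd 𝒳.hom (𝒳 ⊗ 𝒳).hom) (fst 𝒳 𝒳).left (snd 𝒳 𝒳).left := by
  have big : IsPullback (ϖ ≫ (snd 𝒳 𝒳).left) (pullback.snd 𝒳.hom (𝒳 ⊗ 𝒳).hom) 𝒳.hom
      ((snd 𝒳 𝒳).left ≫ 𝒳.hom) := by
    rw [h2, Over.w (snd 𝒳 𝒳)]
    exact IsPullback.of_hasPullback 𝒳.hom (𝒳 ⊗ 𝒳).hom
  exact IsPullback.of_right big h1 (IsPullback.of_hasPullback 𝒳.hom 𝒳.hom).flip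

/-- A morphism `γ : V ×_S (V ×_S V) ⟶ V ×_S V` with coordinates `(u, (a, b)) ↦ (a, u)` is a base change: the square
with `pr₂` and the first projections over `fst : V ×_S V ⟶ V` is cartesian. [folklore] -/
private theorem isPullback_of_coord_fst_swap (γ : pullback 𝒳.hom (𝒳 ⊗ 𝒳).hom ⟶ (𝒳 ⊗ 𝒳).left)
    (h1 : γ ≫ (fst 𝒳 𝒳).left = pullback.snd 𝒳.hom (𝒳 ⊗ 𝒳).hom ≫ (fst 𝒳 𝒳).left)
    (h2 : γ ≫ (snd 𝒳 𝒳).left = pullback.fst 𝒳.hom (𝒳 ⊗ 𝒳).hom) :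
    IsPullback γ (pullback.snd 𝒳.hom (𝒳 ⊗ 𝒳).hom) (fst 𝒳 𝒳).left (fst 𝒳 𝒳).left := by
  have big : IsPullback (γ ≫ (snd 𝒳 𝒳).left) (pullback.snd 𝒳.hom (𝒳 ⊗ 𝒳).hom) 𝒳.hom
      ((fst 𝒳 𝒳).left ≫ 𝒳.hom) := by
    rw [h2, Over.w (fst 𝒳 𝒳)]
    exact IsPullback.of_hasPullback 𝒳.hom (𝒳 ⊗ 𝒳).hom
  exact IsPullback.of_right big h1 (IsPullback.of_hasPullback 𝒳.hom 𝒳.hom).flip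

end Coordinates

/-! ## §3. Right division and the translated law are defined generically over every point -/

namespace BirationalGroupLaw

variable (L : BirationalGroupLaw 𝒳)

/-- **Density of «`b x⁻¹` and `a (b x⁻¹)` defined» in the fibre over a point `(a, b)`** ([Artin1986NeronModels] §2,
last paragraph of the proof of Thm. (1.12), for scheme points).  Let `L` be a STRICT birational group law on `𝒳 → S`
universally open with geometrically irreducible fibres, `Ψ : (y, x) ↦ (y x, x)` its right shear (an open immersion
`dom ↪ V ×_S V` with image `U₂₃ = L.domRightDiv`).  Let `W = V ×_S (V ×_S V)` (Mathlib `pullback 𝒳.hom (𝒳 ⊗ 𝒳).hom`),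
`ϖ : W → V ×_S V` the morphism with coordinates `(x, (a, b)) ↦ (b, x)`, `A ⊆ W` the open `ϖ⁻¹ U₂₃` («`b x⁻¹` is
defined»), `δ : A → dom` the lift `Ψ⁻¹ ∘ ϖ`, and `Θ : A → V ×_S V` the morphism with coordinates
`(x, (a, b)) ↦ (a, pr₁ Ψ⁻¹(b, x)) = (a, b x⁻¹)` (all characterised by their coordinates).  Then for every point `p₀` of
`V ×_S V` the open `{w ∈ A : Θ w ∈ dom}` is dense in the fibre of `pr₂ : W → V ×_S V` over `p₀` — the shape consumed by
`GroupSchemes.exists_open_forall_section_lift_mem`.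
[cite: Artin1986NeronModels, §2, last paragraph of the proof of Thm. (1.12) (p. 222–223) and (2.2) (p. 221)]
[cite: EdixhovenRomagny, Def. 3.4 (2)] -/
theorem fibre_subset_closure_rightDivDom [UniversallyOpen 𝒳.hom] [GeometricallyIrreducible 𝒳.hom]
    (hL : L.IsStrict) (ϖ : pullback 𝒳.hom (𝒳 ⊗ 𝒳).hom ⟶ (𝒳 ⊗ 𝒳).left)
    (hϖ₁ : ϖ ≫ (fst 𝒳 𝒳).left = pullback.snd 𝒳.hom (𝒳 ⊗ 𝒳).hom ≫ (snd 𝒳 𝒳).left)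
    (hϖ₂ : ϖ ≫ (snd 𝒳 𝒳).left = pullback.fst 𝒳.hom (𝒳 ⊗ 𝒳).hom)
    (A : (pullback 𝒳.hom (𝒳 ⊗ 𝒳).hom).Opens)
    (hA : ∀ w : ↑(pullback 𝒳.hom (𝒳 ⊗ 𝒳).hom), w ∈ A ↔ ϖ.base w ∈ L.domRightDiv)
    (δ : (A : Scheme.{u}) ⟶ (L.dom : Scheme.{u}))
    (hδ : δ ≫ (L.shearRight.left : (L.dom : Scheme.{u}) ⟶ (𝒳 ⊗ 𝒳).left) = A.ι ≫ ϖ)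
    (Θ : (A : Scheme.{u}) ⟶ (𝒳 ⊗ 𝒳).left)
    (hΘ₁ : Θ ≫ (fst 𝒳 𝒳).left = A.ι ≫ pullback.snd 𝒳.hom (𝒳 ⊗ 𝒳).hom ≫ (fst 𝒳 𝒳).left)
    (hΘ₂ : Θ ≫ (snd 𝒳 𝒳).left = δ ≫ L.dom.ι ≫ (fst 𝒳 𝒳).left)
    (p₀ : ↑(𝒳 ⊗ 𝒳).left) :
    (pullback.snd 𝒳.hom (𝒳 ⊗ 𝒳).hom) ⁻¹' {p₀} ⊆
      closure (((A.ι ''ᵁ (Θ ⁻¹ᵁ L.dom) : (pullback 𝒳.hom (𝒳 ⊗ 𝒳).hom).Opens) :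
          Set ↑(pullback 𝒳.hom (𝒳 ⊗ 𝒳).hom)) ∩ (pullback.snd 𝒳.hom (𝒳 ⊗ 𝒳).hom) ⁻¹' {p₀}) := by
  -- notation: the two shears retyped on `↑dom`
  let Ψ' : (L.dom : Scheme.{u}) ⟶ (𝒳 ⊗ 𝒳).left := L.shearRight.left
  haveI hΨo : IsOpenImmersion Ψ' := L.isOpenImmersion_shearRight
  have hΨ1 : Ψ' ≫ (fst 𝒳 𝒳).left = L.mul :=
    congrArg CommaMorphism.left (LawData.shearRight_fst 𝒳 L.dom L.mul L.mul_comp)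
  have hΨ2 : Ψ' ≫ (snd 𝒳 𝒳).left = L.dom.ι ≫ (snd 𝒳 𝒳).left :=
    congrArg CommaMorphism.left (LawData.shearRight_snd 𝒳 L.dom L.mul L.mul_comp)
  let Φ' : (L.dom : Scheme.{u}) ⟶ (𝒳 ⊗ 𝒳).left := L.shearLeft.left
  have hΦo : IsOpenImmersion Φ' := L.isOpenImmersion_shearLeft
  have hΦ1 : Φ' ≫ (fst 𝒳 𝒳).left = L.dom.ι ≫ (fst 𝒳 𝒳).left :=
    congrArg CommaMorphism.left (LawData.shearLeft_fst 𝒳 L.dom L.mul L.mul_comp)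
  have hΦ2 : Φ' ≫ (snd 𝒳 𝒳).left = L.mul :=
    congrArg CommaMorphism.left (LawData.shearLeft_snd 𝒳 L.dom L.mul L.mul_comp)
  have hδ' : δ ≫ Ψ' = A.ι ≫ ϖ := hδ
  have hfstS : (fst 𝒳 𝒳).left ≫ 𝒳.hom = (𝒳 ⊗ 𝒳).hom := Over.w (fst 𝒳 𝒳)
  have hsndS : (snd 𝒳 𝒳).left ≫ 𝒳.hom = (𝒳 ⊗ 𝒳).hom := Over.w (snd 𝒳 𝒳)
  have hΨS : Ψ' ≫ (𝒳 ⊗ 𝒳).hom = L.dom.ι ≫ (𝒳 ⊗ 𝒳).hom := by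
    rw [← hfstS, reassoc_of% hΨ1, L.mul_comp, hfstS]
  have hϖS : ϖ ≫ (𝒳 ⊗ 𝒳).hom = (pullback.snd 𝒳.hom (𝒳 ⊗ 𝒳).hom) ≫ (𝒳 ⊗ 𝒳).hom := by
    have h := congrArg (· ≫ 𝒳.hom) hϖ₁
    simp only [Category.assoc] at h
    rwa [hfstS, hsndS] at h
  intro w hw
  -- the fibre `F` over `p₀` is irreducible; take a point `ζ` generic in it
  have hirrF : IsIrreducible ((pullback.snd 𝒳.hom (𝒳 ⊗ 𝒳).hom) ⁻¹' {p₀}) := (pullback.snd 𝒳.hom (𝒳 ⊗ 𝒳).hom).isIrreducible_preimage (pullback.snd 𝒳.hom (𝒳 ⊗ 𝒳).hom).isOpenMap isIrreducible_singleton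
  obtain ⟨ζ, hζy, hζgen⟩ := exists_generic_of_isIrreducible_fibre' (pullback.snd 𝒳.hom (𝒳 ⊗ 𝒳).hom) p₀ hirrF
  -- it suffices to show `ζ ∈ O₂`
  suffices hζO : ζ ∈ ((A.ι ''ᵁ (Θ ⁻¹ᵁ L.dom) : (pullback 𝒳.hom (𝒳 ⊗ 𝒳).hom).Opens) :
      Set ↑(pullback 𝒳.hom (𝒳 ⊗ 𝒳).hom)) by
    have hmem : ζ ∈ ((A.ι ''ᵁ (Θ ⁻¹ᵁ L.dom) : (pullback 𝒳.hom (𝒳 ⊗ 𝒳).hom).Opens) :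
        Set ↑(pullback 𝒳.hom (𝒳 ⊗ 𝒳).hom)) ∩ (pullback.snd 𝒳.hom (𝒳 ⊗ 𝒳).hom) ⁻¹' {p₀} := ⟨hζO, hζy⟩
    exact closure_mono (Set.singleton_subset_iff.mpr hmem) (hζgen hw)
  obtain ⟨⟨hdfst, -⟩, -, ⟨hrfst, -⟩⟩ := hL
  -- (1) `ϖ ζ` is generic in the `fst`-fibre of `V ×_S V` over `b₀ = snd p₀`, hence lies in `U₂₃ = im Ψ`: `ζ ∈ A`
  have hϖpb := isPullback_of_coord_swap 𝒳 ϖ hϖ₁ hϖ₂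
  have hϖζ_fst : (fst 𝒳 𝒳).left (ϖ ζ) = (snd 𝒳 𝒳).left p₀ := by
    change (ϖ ≫ (fst 𝒳 𝒳).left) ζ = _
    rw [hϖ₁]
    change (snd 𝒳 𝒳).left ((pullback.snd 𝒳.hom (𝒳 ⊗ 𝒳).hom) ζ) = _
    rw [hζy]
  have hGb : (fst 𝒳 𝒳).left ⁻¹' {(snd 𝒳 𝒳).left p₀} ⊆ closure {ϖ ζ} := by
    refine subset_closure_image_of_surjOn' ϖ hζgen fun d hd => ?_
    obtain ⟨w', hw'1, hw'2⟩ := Scheme.exists_preimage_of_isPullback hϖpb d p₀ hd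
    exact ⟨w', hw'2, hw'1⟩
  have hϖζ : ϖ ζ ∈ L.domRightDiv :=
    mem_of_isOpen_of_inter_nonempty' hGb Ψ'.isOpenEmbedding.isOpen_range
      (hrfst.nonempty_inter_fibre ⟨ϖ ζ, hϖζ_fst⟩)
  have hζA : ζ ∈ A := (hA ζ).2 hϖζ
  obtain ⟨ζA, hζA'⟩ : ζ ∈ Set.range A.ι := by rw [Scheme.Opens.range_ι]; exact hζA
  -- (2) the morphism `Ψ₃ : A ⟶ W`, `(x, (a, b)) ↦ (c, (a, b))` with `c = (pullback.fst 𝒳.hom (𝒳 ⊗ 𝒳).hom) Ψ⁻¹(b, x)`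
  have hw3 : (δ ≫ L.dom.ι ≫ (fst 𝒳 𝒳).left) ≫ 𝒳.hom = (A.ι ≫ (pullback.snd 𝒳.hom (𝒳 ⊗ 𝒳).hom)) ≫ (𝒳 ⊗ 𝒳).hom := by
    simp only [Category.assoc]
    rw [hfstS, ← hΨS, reassoc_of% hδ', hϖS]
  let Ψ₃ : (A : Scheme.{u}) ⟶ pullback 𝒳.hom (𝒳 ⊗ 𝒳).hom :=
    pullback.lift (δ ≫ L.dom.ι ≫ (fst 𝒳 𝒳).left) (A.ι ≫ (pullback.snd 𝒳.hom (𝒳 ⊗ 𝒳).hom)) hw3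
  have hΨ₃1 : Ψ₃ ≫ (pullback.fst 𝒳.hom (𝒳 ⊗ 𝒳).hom) = δ ≫ L.dom.ι ≫ (fst 𝒳 𝒳).left := pullback.lift_fst _ _ _
  have hΨ₃2 : Ψ₃ ≫ (pullback.snd 𝒳.hom (𝒳 ⊗ 𝒳).hom) = A.ι ≫ (pullback.snd 𝒳.hom (𝒳 ⊗ 𝒳).hom) := pullback.lift_snd _ _ _
  -- the morphism `β : W ⟶ V ×_S V`, `(u, (a, b)) ↦ (u, b)`
  have hwβ : (pullback.fst 𝒳.hom (𝒳 ⊗ 𝒳).hom) ≫ 𝒳.hom = ((pullback.snd 𝒳.hom (𝒳 ⊗ 𝒳).hom) ≫ (snd 𝒳 𝒳).left) ≫ 𝒳.hom := by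
    rw [Category.assoc, hsndS, pullback.condition]
  let β : pullback 𝒳.hom (𝒳 ⊗ 𝒳).hom ⟶ (𝒳 ⊗ 𝒳).left := pullback.lift (pullback.fst 𝒳.hom (𝒳 ⊗ 𝒳).hom) ((pullback.snd 𝒳.hom (𝒳 ⊗ 𝒳).hom) ≫ (snd 𝒳 𝒳).left) hwβ
  have hβ1 : β ≫ (fst 𝒳 𝒳).left = (pullback.fst 𝒳.hom (𝒳 ⊗ 𝒳).hom) := pullback.lift_fst _ _ _
  have hβ2 : β ≫ (snd 𝒳 𝒳).left = (pullback.snd 𝒳.hom (𝒳 ⊗ 𝒳).hom) ≫ (snd 𝒳 𝒳).left := pullback.lift_snd _ _ _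
  -- the square `A —Ψ₃→ W —β→ V ×_S V ←Φ— dom ←δ— A` commutes …
  have hsq : Ψ₃ ≫ β = δ ≫ Φ' := by
    apply pullback.hom_ext
    · change (Ψ₃ ≫ β) ≫ (fst 𝒳 𝒳).left = (δ ≫ Φ') ≫ (fst 𝒳 𝒳).left
      rw [Category.assoc, hβ1, hΨ₃1, Category.assoc, hΦ1]
    · change (Ψ₃ ≫ β) ≫ (snd 𝒳 𝒳).left = (δ ≫ Φ') ≫ (snd 𝒳 𝒳).left
      rw [Category.assoc, hβ2, reassoc_of% hΨ₃2, ← hϖ₁, ← reassoc_of% hδ', hΨ1, Category.assoc, hΦ2]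
  -- … and is cartesian: cone data
  have hcone : ∀ t : PullbackCone β Φ',
      (t.snd ≫ L.dom.ι ≫ (snd 𝒳 𝒳).left) ≫ 𝒳.hom = (t.fst ≫ (pullback.snd 𝒳.hom (𝒳 ⊗ 𝒳).hom)) ≫ (𝒳 ⊗ 𝒳).hom := fun t => by
    have h := congrArg (· ≫ (fst 𝒳 𝒳).left ≫ 𝒳.hom) t.condition
    simp only [Category.assoc] at h
    rw [reassoc_of% hβ1, reassoc_of% hΦ1, pullback.condition] at h
    simp only [Category.assoc]
    rw [hsndS, h, hfstS]
  have hconeϖ : ∀ t : PullbackCone β Φ',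
      pullback.lift (t.snd ≫ L.dom.ι ≫ (snd 𝒳 𝒳).left) (t.fst ≫ (pullback.snd 𝒳.hom (𝒳 ⊗ 𝒳).hom)) (hcone t) ≫ ϖ = t.snd ≫ Ψ' := fun t => by
    have h2 := congrArg (· ≫ (snd 𝒳 𝒳).left) t.condition
    simp only [Category.assoc, hβ2, hΦ2] at h2
    apply pullback.hom_ext
    · change (_ ≫ ϖ) ≫ (fst 𝒳 𝒳).left = (t.snd ≫ Ψ') ≫ (fst 𝒳 𝒳).left
      have e : pullback.lift (t.snd ≫ L.dom.ι ≫ (snd 𝒳 𝒳).left) (t.fst ≫ (pullback.snd 𝒳.hom (𝒳 ⊗ 𝒳).hom)) (hcone t) ≫ (pullback.snd 𝒳.hom (𝒳 ⊗ 𝒳).hom) = t.fst ≫ (pullback.snd 𝒳.hom (𝒳 ⊗ 𝒳).hom) :=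
        pullback.lift_snd _ _ _
      rw [Category.assoc, hϖ₁, reassoc_of% e, Category.assoc, hΨ1]
      exact h2
    · change (_ ≫ ϖ) ≫ (snd 𝒳 𝒳).left = (t.snd ≫ Ψ') ≫ (snd 𝒳 𝒳).left
      rw [Category.assoc, hϖ₂, pullback.lift_fst, Category.assoc, hΨ2]
  have hconeRange : ∀ t : PullbackCone β Φ',
      Set.range (pullback.lift (t.snd ≫ L.dom.ι ≫ (snd 𝒳 𝒳).left) (t.fst ≫ (pullback.snd 𝒳.hom (𝒳 ⊗ 𝒳).hom)) (hcone t)) ⊆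
        Set.range A.ι := fun t => by
    rintro _ ⟨x, rfl⟩
    rw [Scheme.Opens.range_ι, SetLike.mem_coe, hA]
    change (pullback.lift (t.snd ≫ L.dom.ι ≫ (snd 𝒳 𝒳).left) (t.fst ≫ (pullback.snd 𝒳.hom (𝒳 ⊗ 𝒳).hom)) (hcone t) ≫ ϖ) x ∈ L.domRightDiv
    rw [hconeϖ]
    exact ⟨t.snd x, rfl⟩
  have hpb : IsPullback Ψ₃ δ β Φ' := by
    refine IsPullback.of_isLimit' ⟨hsq⟩ (PullbackCone.IsLimit.mk hsq
      (fun t => IsOpenImmersion.lift A.ι _ (hconeRange t))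
      (fun t => ?_) (fun t => ?_) (fun t m hm₁ hm₂ => ?_))
    · -- `lift ≫ Ψ₃ = t.fst`
      have e2 : IsOpenImmersion.lift A.ι _ (hconeRange t) ≫ δ = t.snd := by
        rw [← cancel_mono Ψ', Category.assoc, hδ', ← Category.assoc, IsOpenImmersion.lift_fac]
        exact hconeϖ t
      have h1 := congrArg (· ≫ (fst 𝒳 𝒳).left) t.condition
      simp only [Category.assoc, hβ1, hΦ1] at h1
      apply pullback.hom_ext
      · rw [Category.assoc, hΨ₃1, ← Category.assoc, e2]
        exact h1.symm
      · rw [Category.assoc, hΨ₃2, ← Category.assoc, IsOpenImmersion.lift_fac, pullback.lift_snd]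
    · -- `lift ≫ δ = t.snd`
      rw [← cancel_mono Ψ', Category.assoc, hδ', ← Category.assoc, IsOpenImmersion.lift_fac]
      exact hconeϖ t
    · -- uniqueness
      rw [← cancel_mono A.ι, IsOpenImmersion.lift_fac]
      apply pullback.hom_ext
      · rw [pullback.lift_fst, Category.assoc, ← hϖ₂, ← reassoc_of% hδ', reassoc_of% hm₂, hΨ2]
      · rw [pullback.lift_snd, Category.assoc, ← hΨ₃2, ← Category.assoc, hm₁]
  have hΨ₃o : IsOpenImmersion Ψ₃ :=
    MorphismProperty.IsStableUnderBaseChange.of_isPullback (P := @IsOpenImmersion) hpb.flip hΦo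
  -- `F ⊆ closure {Ψ₃ ζA}`
  have hζAF : (pullback.snd 𝒳.hom (𝒳 ⊗ 𝒳).hom) (Ψ₃ ζA) = p₀ := by
    change (Ψ₃ ≫ (pullback.snd 𝒳.hom (𝒳 ⊗ 𝒳).hom)) ζA = p₀
    rw [hΨ₃2]
    change (pullback.snd 𝒳.hom (𝒳 ⊗ 𝒳).hom) (A.ι ζA) = p₀
    rw [hζA', hζy]
  have hFΨ : (pullback.snd 𝒳.hom (𝒳 ⊗ 𝒳).hom) ⁻¹' {p₀} ⊆ closure {Ψ₃ ζA} := by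
    have hU : IsOpen (Set.range Ψ₃) := Ψ₃.isOpenEmbedding.isOpen_range
    have hne : ((pullback.snd 𝒳.hom (𝒳 ⊗ 𝒳).hom) ⁻¹' {p₀} ∩ Set.range Ψ₃).Nonempty := ⟨Ψ₃ ζA, hζAF, ζA, rfl⟩
    refine (subset_closure_inter_of_isPreirreducible_of_isOpen hirrF.isPreirreducible hU hne).trans
      ((isClosed_closure).closure_subset_iff.mpr ?_)
    rintro _ ⟨hu, a', rfl⟩
    have ha'F : A.ι a' ∈ (pullback.snd 𝒳.hom (𝒳 ⊗ 𝒳).hom) ⁻¹' {p₀} := by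
      change (A.ι ≫ (pullback.snd 𝒳.hom (𝒳 ⊗ 𝒳).hom)) a' = p₀
      rw [← hΨ₃2]
      exact hu
    have ha'cl : a' ∈ closure ({ζA} : Set ↑A) := by
      have h1 : A.ι a' ∈ closure {ζ} := hζgen ha'F
      rw [← hζA'] at h1
      have h2 := A.ι.isOpenEmbedding.isOpenMap.preimage_closure_eq_closure_preimage A.ι.continuous {A.ι ζA}
      have h3 : a' ∈ A.ι ⁻¹' closure {A.ι ζA} := h1
      rw [h2, ← Set.image_singleton, Set.preimage_image_eq _ A.ι.isOpenEmbedding.injective] at h3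
      exact h3
    have := image_closure_subset_closure_image Ψ₃.continuous ⟨a', ha'cl, rfl⟩
    rwa [Set.image_singleton] at this
  -- (3) the morphism `γ : W ⟶ V ×_S V`, `(u, (a, b)) ↦ (a, u)`, maps `F` onto the `fst`-fibre over `a₀ = fst p₀`
  have hwγ : ((pullback.snd 𝒳.hom (𝒳 ⊗ 𝒳).hom) ≫ (fst 𝒳 𝒳).left) ≫ 𝒳.hom = (pullback.fst 𝒳.hom (𝒳 ⊗ 𝒳).hom) ≫ 𝒳.hom := by
    rw [Category.assoc, hfstS, pullback.condition]
  let γ : pullback 𝒳.hom (𝒳 ⊗ 𝒳).hom ⟶ (𝒳 ⊗ 𝒳).left := pullback.lift ((pullback.snd 𝒳.hom (𝒳 ⊗ 𝒳).hom) ≫ (fst 𝒳 𝒳).left) (pullback.fst 𝒳.hom (𝒳 ⊗ 𝒳).hom) hwγ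
  have hγ1 : γ ≫ (fst 𝒳 𝒳).left = (pullback.snd 𝒳.hom (𝒳 ⊗ 𝒳).hom) ≫ (fst 𝒳 𝒳).left := pullback.lift_fst _ _ _
  have hγ2 : γ ≫ (snd 𝒳 𝒳).left = (pullback.fst 𝒳.hom (𝒳 ⊗ 𝒳).hom) := pullback.lift_snd _ _ _
  have hγpb := isPullback_of_coord_fst_swap 𝒳 γ hγ1 hγ2
  have hGa : (fst 𝒳 𝒳).left ⁻¹' {(fst 𝒳 𝒳).left p₀} ⊆ closure {γ (Ψ₃ ζA)} := by
    refine subset_closure_image_of_surjOn' γ hFΨ fun d hd => ?_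
    obtain ⟨w', hw'1, hw'2⟩ := Scheme.exists_preimage_of_isPullback hγpb d p₀ hd
    exact ⟨w', hw'2, hw'1⟩
  -- `Θ = Ψ₃ ≫ γ`
  have hΘ : Θ = Ψ₃ ≫ γ := by
    apply pullback.hom_ext
    · change Θ ≫ (fst 𝒳 𝒳).left = (Ψ₃ ≫ γ) ≫ (fst 𝒳 𝒳).left
      rw [hΘ₁, Category.assoc, hγ1, reassoc_of% hΨ₃2]
    · change Θ ≫ (snd 𝒳 𝒳).left = (Ψ₃ ≫ γ) ≫ (snd 𝒳 𝒳).left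
      rw [hΘ₂, Category.assoc, hγ2, hΨ₃1]
  have hΘζ_fst : (fst 𝒳 𝒳).left (Θ ζA) = (fst 𝒳 𝒳).left p₀ := by
    change (Θ ≫ (fst 𝒳 𝒳).left) ζA = _
    rw [hΘ₁]
    change (fst 𝒳 𝒳).left ((pullback.snd 𝒳.hom (𝒳 ⊗ 𝒳).hom) (A.ι ζA)) = _
    rw [hζA', hζy]
  have hΘζ : Θ ζA ∈ L.dom := by
    have hG : (fst 𝒳 𝒳).left ⁻¹' {(fst 𝒳 𝒳).left p₀} ⊆ closure {Θ ζA} := by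
      rw [hΘ]; exact hGa
    exact mem_of_isOpen_of_inter_nonempty' hG L.dom.2 (hdfst.nonempty_inter_fibre ⟨Θ ζA, hΘζ_fst⟩)
  -- conclude
  rw [← hζA']
  exact ⟨ζA, hΘζ, rfl⟩

end BirationalGroupLaw

end Literature.AlgebraicGeometry.GroupSchemes

end
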